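import Summits.Ventures.Crystal3D.Theorems.StickyWulffConstantGenericWallFloorLedgerOfAt
import Summits.Ventures.Crystal3D.Theorems.StickyWulffConstantCoaxialWallLawVicinalSplit
import Summits.Ventures.Crystal3D.Theorems.StickyWulffConstantCoaxialWallLawUnifFromDefs
import Summits.Ventures.Crystal3D.Theorems.StickyWulffConstantTextureLiminfTexShadowSampleDeficitUpperUnif
import HarnessLib

/-!
# The explicit-constant currency of the wall ledgers: `TwoSlabLedgerWith C R₀ q`, `CoaxialTwoSlabAdhesionOnWith C R₀ S`

HONEST FRAMING. Venture `Summits/Ventures/Crystal3D` (cell `crystal3d-full`); helper for the crux `TextureLiminf`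
(stmt-Ventures-19483, line `TexShadow`) and for lane F's debt F-U (`CoaxialTwoSlabAdhesionUnifFrom`, crux
`CoaxialWallLaw`).  DEFINITIONS + BOOKKEEPING ONLY (census-free, standard axioms); F-C1 not moved; nothing about the
crux is claimed.  cf-p1 DECISION (lxv) (2026-08-29T00:06:46Z), item n1′ «F-U re-thread», and the constant audit posted
00:5xZ: every adhesion-form leaf of lanes F/G concludes the per-pair EXISTENTIAL `TwoSlabLedgerAt q A₁ t₁ A₂ t₂ := ∃ C R₀,
…` (resp. `CoaxialTwoSlabAdhesionOn S`), and the only pair-dependent input of any leaf is the sample-deficit constant of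
`affineSampleDeficit_upper`, now absolute (`affineSampleDeficit_upper_unif`).  To state the laws UNIFORMLY the constants
must be exposed; this file is the currency for that restatement programme.

* `TwoSlabLedgerWith C R₀ q A₁ t₁ A₂ t₂` — the matrix of `TwoSlabLedgerAt q` AT the constants `(C, R₀)`;
  `twoSlabLedgerAt_of_with`; monotonicity in `C` (`…_weaken`) and in the charge (`…_anti`).
* `CoaxialTwoSlabAdhesionOnWith C R₀ S` — `CoaxialTwoSlabAdhesionOn S` AT `(C, R₀)`; `…On_of_onWith`, `…OnWith_mono`,
  `…OnWith_weaken`, `…OnWith_split`, and the identification with lane F's uniform text: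
  `coaxialTwoSlabAdhesionUnifAt_iff_onWith_univ`, `coaxialTwoSlabAdhesionUnifFrom_of_onWith`.
* **`twoSlabLedgerWith_of_atCharge_unif`** — the deficiency ⇒ adhesion converter of `twoSlabLedgerAt_of_atCharge` with the
  UNIFORM sample bound: one absolute `K ≥ 0` such that a deficiency-form cell at `(C, R₀)`, `R₀ ≥ 1`, gives
  `TwoSlabLedgerWith (|C| + K (1 + R₀)) R₀ c`.

WHAT THIS IS NOT: no leaf is restated here; F-U is not proved here.
-/

noncomputable section

namespace Summit.Ventures.Crystal3D.Theorems

open Summit.Ventures.Crystal3D Finset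
open Summit.Ventures.Crystal3D.Cruxes.CoaxialWallLaw.WallLedgerF (CoaxialTwoSlabAdhesion)
open Literature.MathematicalPhysics.StatisticalMechanics (fccStacking barlowStacking IsHaggSeq contactDeficiency)
open scoped InnerProductSpace

/-! ### The two-slab matrix at explicit constants -/

/-- **`TwoSlabLedgerAt q` AT the constants `(C, R₀)`**: the clamped-cylinder cell inequality
`cross(P₁, X∖P₁) + cross(P₂, Y) ≤ D(Y) + (φ₁ + φ₂ − q) π ρ² + C (1 + h) ρ` for every `h ≥ 0`, `ρ ≥ R₀`. -/
def TwoSlabLedgerWith (C R₀ q : ℝ) (A₁ : EuclideanSpace ℝ (Fin 3) ≃ₗᵢ[ℝ] EuclideanSpace ℝ (Fin 3)) (t₁ : EuclideanSpace ℝ (Fin 3))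
    (A₂ : EuclideanSpace ℝ (Fin 3) ≃ₗᵢ[ℝ] EuclideanSpace ℝ (Fin 3)) (t₂ : EuclideanSpace ℝ (Fin 3)) : Prop :=
  ∀ h : ℝ, 0 ≤ h → ∀ ρ : ℝ, R₀ ≤ ρ →
    ∀ X P₁ P₂ : Finset (EuclideanSpace ℝ (Fin 3)),
    (∀ p ∈ X, ∀ q ∈ X, p ≠ q → 1 ≤ dist p q) → P₁ ⊆ X → P₂ ⊆ X \ P₁ →
    (∀ p ∈ X, -(2 * R₀) ≤ p 2 ∧ p 2 ≤ h + 2 * R₀ ∧ p 0 ^ 2 + p 1 ^ 2 ≤ ρ ^ 2) →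
    (∀ p, p ∈ P₁ ↔ (p ∈ (fun q => A₁ q + t₁) '' fccStacking 1 (Real.sqrt (2 / 3)) ∧
      -(2 * R₀) ≤ p 2 ∧ p 2 ≤ -R₀ ∧ p 0 ^ 2 + p 1 ^ 2 ≤ ρ ^ 2)) →
    (∀ p, p ∈ P₂ ↔ (p ∈ (fun q => A₂ q + t₂) '' fccStacking 1 (Real.sqrt (2 / 3)) ∧
      h + R₀ ≤ p 2 ∧ p 2 ≤ h + 2 * R₀ ∧ p 0 ^ 2 + p 1 ^ 2 ≤ ρ ^ 2)) →
    ((((P₁ ×ˢ (X \ P₁)).filter fun pq => dist pq.1 pq.2 = 1).card : ℕ) : ℝ) +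
      ((((P₂ ×ˢ ((X \ P₁) \ P₂)).filter fun pq => dist pq.1 pq.2 = 1).card : ℕ) : ℝ) ≤
      contactDeficiency ((X \ P₁) \ P₂) +
        (Real.sqrt 2 / 4 * ∑ᶠ w ∈ {w ∈ fccStacking 1 (Real.sqrt (2 / 3)) | ‖w‖ = 1},
            |⟪w, A₁.symm (EuclideanSpace.single (2 : Fin 3) (1 : ℝ))⟫_ℝ| +
          Real.sqrt 2 / 4 * ∑ᶠ w ∈ {w ∈ fccStacking 1 (Real.sqrt (2 / 3)) | ‖w‖ = 1},
            |⟪w, A₂.symm (EuclideanSpace.single (2 : Fin 3) (1 : ℝ))⟫_ℝ| - q) * Real.pi * ρ ^ 2 +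
        C * (1 + h) * ρ

/-- `TwoSlabLedgerWith C R₀ q` with `R₀ ≥ 1` gives the existential `TwoSlabLedgerAt q`. -/
theorem twoSlabLedgerAt_of_with {C R₀ q : ℝ} {A₁ : EuclideanSpace ℝ (Fin 3) ≃ₗᵢ[ℝ] EuclideanSpace ℝ (Fin 3)} {t₁ : EuclideanSpace ℝ (Fin 3)}
    {A₂ : EuclideanSpace ℝ (Fin 3) ≃ₗᵢ[ℝ] EuclideanSpace ℝ (Fin 3)} {t₂ : EuclideanSpace ℝ (Fin 3)} (hR₀ : 1 ≤ R₀)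
    (h : TwoSlabLedgerWith C R₀ q A₁ t₁ A₂ t₂) : TwoSlabLedgerAt q A₁ t₁ A₂ t₂ :=
  ⟨C, R₀, hR₀, h⟩

/-- Enlarging the constant `C` (with `R₀ ≥ 0`) only weakens the matrix. -/
theorem twoSlabLedgerWith_weaken {C C' R₀ q : ℝ} {A₁ : EuclideanSpace ℝ (Fin 3) ≃ₗᵢ[ℝ] EuclideanSpace ℝ (Fin 3)} {t₁ : EuclideanSpace ℝ (Fin 3)}
    {A₂ : EuclideanSpace ℝ (Fin 3) ≃ₗᵢ[ℝ] EuclideanSpace ℝ (Fin 3)} {t₂ : EuclideanSpace ℝ (Fin 3)} (hR₀ : 0 ≤ R₀) (hCC : C ≤ C')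
    (h : TwoSlabLedgerWith C R₀ q A₁ t₁ A₂ t₂) : TwoSlabLedgerWith C' R₀ q A₁ t₁ A₂ t₂ := by
  intro hh hh0 ρ hρ X P₁ P₂ hX hP₁ hP₂ hcell hP₁i hP₂i
  have hle := h hh hh0 ρ hρ X P₁ P₂ hX hP₁ hP₂ hcell hP₁i hP₂i
  have hρ0 : 0 ≤ ρ := hR₀.trans hρ
  have : C * (1 + hh) * ρ ≤ C' * (1 + hh) * ρ :=
    mul_le_mul_of_nonneg_right (mul_le_mul_of_nonneg_right hCC (by linarith)) hρ0
  linarith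

/-- Lowering the charge `q` only weakens the matrix. -/
theorem twoSlabLedgerWith_anti {C R₀ q q' : ℝ} {A₁ : EuclideanSpace ℝ (Fin 3) ≃ₗᵢ[ℝ] EuclideanSpace ℝ (Fin 3)} {t₁ : EuclideanSpace ℝ (Fin 3)}
    {A₂ : EuclideanSpace ℝ (Fin 3) ≃ₗᵢ[ℝ] EuclideanSpace ℝ (Fin 3)} {t₂ : EuclideanSpace ℝ (Fin 3)} (hqq : q ≤ q')
    (h : TwoSlabLedgerWith C R₀ q' A₁ t₁ A₂ t₂) : TwoSlabLedgerWith C R₀ q A₁ t₁ A₂ t₂ := by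
  intro hh hh0 ρ hρ X P₁ P₂ hX hP₁ hP₂ hcell hP₁i hP₂i
  have hle := h hh hh0 ρ hρ X P₁ P₂ hX hP₁ hP₂ hcell hP₁i hP₂i
  have : 0 ≤ (q' - q) * Real.pi * ρ ^ 2 :=
    mul_nonneg (mul_nonneg (sub_nonneg.2 hqq) Real.pi_pos.le) (sq_nonneg ρ)
  linarith

/-! ### The restricted co-axial stub at explicit constants -/

/-- **`CoaxialTwoSlabAdhesionOn S` AT the constants `(C, R₀)`**: for every co-axial pair of distinct moved fcc lattices
satisfying `S` there are shared-frame data `(L, s₁, s₂, σ, σ′)` with the cell inequality at charge `½ √(1 − ⟪L e₃, e₃⟫²)`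
holding AT `(C, R₀)`. -/
def CoaxialTwoSlabAdhesionOnWith (C R₀ : ℝ) (S : CoaxialPairPred) : Prop :=
    ∀ (A₁ : EuclideanSpace ℝ (Fin 3) ≃ₗᵢ[ℝ] EuclideanSpace ℝ (Fin 3)) (t₁ : EuclideanSpace ℝ (Fin 3))
      (A₂ : EuclideanSpace ℝ (Fin 3) ≃ₗᵢ[ℝ] EuclideanSpace ℝ (Fin 3)) (t₂ : EuclideanSpace ℝ (Fin 3)),
    (∃ (L : EuclideanSpace ℝ (Fin 3) ≃ₗᵢ[ℝ] EuclideanSpace ℝ (Fin 3))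
        (s₁ s₂ : EuclideanSpace ℝ (Fin 3)) (σ σ' : ℤ → ℤ), IsHaggSeq σ ∧ IsHaggSeq σ' ∧
        (fun p => A₁ p + t₁) '' fccStacking 1 (Real.sqrt (2 / 3)) ⊆
          (fun p => L p + s₁) '' barlowStacking 1 (Real.sqrt (2 / 3)) σ ∧
        (fun p => A₂ p + t₂) '' fccStacking 1 (Real.sqrt (2 / 3)) ⊆
          (fun p => L p + s₂) '' barlowStacking 1 (Real.sqrt (2 / 3)) σ') →
    (fun p => A₁ p + t₁) '' fccStacking 1 (Real.sqrt (2 / 3)) ≠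
      (fun p => A₂ p + t₂) '' fccStacking 1 (Real.sqrt (2 / 3)) →
    S A₁ t₁ A₂ t₂ →
    ∃ (L : EuclideanSpace ℝ (Fin 3) ≃ₗᵢ[ℝ] EuclideanSpace ℝ (Fin 3))
        (s₁ s₂ : EuclideanSpace ℝ (Fin 3)) (σ σ' : ℤ → ℤ), IsHaggSeq σ ∧ IsHaggSeq σ' ∧
        (fun p => A₁ p + t₁) '' fccStacking 1 (Real.sqrt (2 / 3)) ⊆
          (fun p => L p + s₁) '' barlowStacking 1 (Real.sqrt (2 / 3)) σ ∧
        (fun p => A₂ p + t₂) '' fccStacking 1 (Real.sqrt (2 / 3)) ⊆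
          (fun p => L p + s₂) '' barlowStacking 1 (Real.sqrt (2 / 3)) σ' ∧
        TwoSlabLedgerWith C R₀ ((1 / 2 : ℝ) * Real.sqrt (1 - ⟪L (EuclideanSpace.single (2 : Fin 3) (1 : ℝ)),
          (EuclideanSpace.single (2 : Fin 3) (1 : ℝ))⟫_ℝ ^ 2)) A₁ t₁ A₂ t₂

/-- The explicit-constant form (with `R₀ ≥ 1`) gives the existential `CoaxialTwoSlabAdhesionOn S`. -/
theorem coaxialTwoSlabAdhesionOn_of_onWith {C R₀ : ℝ} {S : CoaxialPairPred} (hR₀ : 1 ≤ R₀)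
    (h : CoaxialTwoSlabAdhesionOnWith C R₀ S) : CoaxialTwoSlabAdhesionOn S := by
  intro A₁ t₁ A₂ t₂ hco hne hS
  obtain ⟨L, s₁, s₂, σ, σ', hσ, hσ', h₁, h₂, hcell⟩ := h A₁ t₁ A₂ t₂ hco hne hS
  exact ⟨L, s₁, s₂, σ, σ', hσ, hσ', h₁, h₂, C, R₀, hR₀, hcell⟩

/-- Monotonicity in the pair predicate. -/
theorem coaxialTwoSlabAdhesionOnWith_mono {C R₀ : ℝ} {S T : CoaxialPairPred}
    (hST : ∀ A₁ t₁ A₂ t₂, S A₁ t₁ A₂ t₂ → T A₁ t₁ A₂ t₂) (h : CoaxialTwoSlabAdhesionOnWith C R₀ T) :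
    CoaxialTwoSlabAdhesionOnWith C R₀ S :=
  fun A₁ t₁ A₂ t₂ hco hne hS => h A₁ t₁ A₂ t₂ hco hne (hST A₁ t₁ A₂ t₂ hS)

/-- Enlarging `C` (with `R₀ ≥ 0`) only weakens the restricted stub. -/
theorem coaxialTwoSlabAdhesionOnWith_weaken {C C' R₀ : ℝ} {S : CoaxialPairPred} (hR₀ : 0 ≤ R₀) (hCC : C ≤ C')
    (h : CoaxialTwoSlabAdhesionOnWith C R₀ S) : CoaxialTwoSlabAdhesionOnWith C' R₀ S := by
  intro A₁ t₁ A₂ t₂ hco hne hS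
  obtain ⟨L, s₁, s₂, σ, σ', hσ, hσ', h₁, h₂, hcell⟩ := h A₁ t₁ A₂ t₂ hco hne hS
  exact ⟨L, s₁, s₂, σ, σ', hσ, hσ', h₁, h₂, twoSlabLedgerWith_weaken hR₀ hCC hcell⟩

/-- **Split** along a further predicate `Q`, at common constants. -/
theorem coaxialTwoSlabAdhesionOnWith_split {C R₀ : ℝ} {S : CoaxialPairPred} (Q : CoaxialPairPred)
    (h₁ : CoaxialTwoSlabAdhesionOnWith C R₀ fun A₁ t₁ A₂ t₂ => S A₁ t₁ A₂ t₂ ∧ Q A₁ t₁ A₂ t₂)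
    (h₂ : CoaxialTwoSlabAdhesionOnWith C R₀ fun A₁ t₁ A₂ t₂ => S A₁ t₁ A₂ t₂ ∧ ¬ Q A₁ t₁ A₂ t₂) :
    CoaxialTwoSlabAdhesionOnWith C R₀ S := by
  intro A₁ t₁ A₂ t₂ hco hne hS
  by_cases hQ : Q A₁ t₁ A₂ t₂
  · exact h₁ A₁ t₁ A₂ t₂ hco hne ⟨hS, hQ⟩
  · exact h₂ A₁ t₁ A₂ t₂ hco hne ⟨hS, hQ⟩

/-- **Split at different constants** (`R₀ ≥ 0` common): the union holds at `max C₁ C₂`. -/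
theorem coaxialTwoSlabAdhesionOnWith_split_max {C₁ C₂ R₀ : ℝ} {S : CoaxialPairPred} (hR₀ : 0 ≤ R₀)
    (Q : CoaxialPairPred)
    (h₁ : CoaxialTwoSlabAdhesionOnWith C₁ R₀ fun A₁ t₁ A₂ t₂ => S A₁ t₁ A₂ t₂ ∧ Q A₁ t₁ A₂ t₂)
    (h₂ : CoaxialTwoSlabAdhesionOnWith C₂ R₀ fun A₁ t₁ A₂ t₂ => S A₁ t₁ A₂ t₂ ∧ ¬ Q A₁ t₁ A₂ t₂) :
    CoaxialTwoSlabAdhesionOnWith (max C₁ C₂) R₀ S :=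
  coaxialTwoSlabAdhesionOnWith_split Q (coaxialTwoSlabAdhesionOnWith_weaken hR₀ (le_max_left _ _) h₁)
    (coaxialTwoSlabAdhesionOnWith_weaken hR₀ (le_max_right _ _) h₂)

/-! ### Identification with lane F's uniform text -/

/-- `CoaxialTwoSlabAdhesionUnifAt C R₀` is the restricted stub at `(C, R₀)` on ALL pairs. -/
theorem coaxialTwoSlabAdhesionUnifAt_iff_onWith_univ (C R₀ : ℝ) :
    CoaxialTwoSlabAdhesionUnifAt C R₀ ↔ CoaxialTwoSlabAdhesionOnWith C R₀ fun _ _ _ _ => True := by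
  constructor
  · intro h A₁ t₁ A₂ t₂ hco hne _
    obtain ⟨L, s₁, s₂, σ, σ', hσ, hσ', h₁, h₂, hcell⟩ := h A₁ t₁ A₂ t₂ hco hne
    exact ⟨L, s₁, s₂, σ, σ', hσ, hσ', h₁, h₂, hcell⟩
  · intro h A₁ t₁ A₂ t₂ hco hne
    obtain ⟨L, s₁, s₂, σ, σ', hσ, hσ', h₁, h₂, hcell⟩ := h A₁ t₁ A₂ t₂ hco hne trivial
    exact ⟨L, s₁, s₂, σ, σ', hσ, hσ', h₁, h₂, hcell⟩

/-- **F-U from the explicit-constant stub on all pairs, thickness by thickness.** -/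
theorem coaxialTwoSlabAdhesionUnifFrom_of_onWith {R : ℝ}
    (h : ∀ R₀ : ℝ, R ≤ R₀ → ∃ C : ℝ, CoaxialTwoSlabAdhesionOnWith C R₀ fun _ _ _ _ => True) :
    CoaxialTwoSlabAdhesionUnifFrom R := fun R₀ hR₀ => by
  obtain ⟨C, hC⟩ := h R₀ hR₀
  exact ⟨C, (coaxialTwoSlabAdhesionUnifAt_iff_onWith_univ C R₀).2 hC⟩

/-! ### The deficiency ⇒ adhesion converter with the UNIFORM sample bound -/

/-- **Deficiency-form matrix at `(C, R₀)`, `R₀ ≥ 1` ⇒ `TwoSlabLedgerWith (|C| + K (1 + R₀)) R₀ c`** with ONE absolute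
`K ≥ 0` (twice the uniform sample-deficit constant of `affineSampleDeficit_upper_unif`): the proof of
`twoSlabLedgerAt_of_atCharge` verbatim with the uniform sample bound. -/
theorem twoSlabLedgerWith_of_atCharge_unif : ∃ K : ℝ, 0 ≤ K ∧ ∀ {c : ℝ}
    (A₁ : EuclideanSpace ℝ (Fin 3) ≃ₗᵢ[ℝ] EuclideanSpace ℝ (Fin 3)) (t₁ : EuclideanSpace ℝ (Fin 3))
    (A₂ : EuclideanSpace ℝ (Fin 3) ≃ₗᵢ[ℝ] EuclideanSpace ℝ (Fin 3)) (t₂ : EuclideanSpace ℝ (Fin 3))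
    {C R₀ : ℝ}, 1 ≤ R₀ →
    (∀ h : ℝ, 0 ≤ h → ∀ ρ : ℝ, R₀ ≤ ρ → ∀ (N : ℕ) (x : Fin N → EuclideanSpace ℝ (Fin 3)),
      Summit.Ventures.Crystal3D.IsUnitPacking x → (∀ i, -(2 * R₀) ≤ x i 2 ∧ x i 2 ≤ h + 2 * R₀ ∧ x i 0 ^ 2 + x i 1 ^ 2 ≤ ρ ^ 2) →
      (∀ p ∈ (fun p => A₁ p + t₁) '' fccStacking 1 (Real.sqrt (2 / 3)),
        (-(2 * R₀) ≤ p 2 ∧ p 2 ≤ -R₀ ∧ p 0 ^ 2 + p 1 ^ 2 ≤ ρ ^ 2) → ∃ i, x i = p) →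
      (∀ p ∈ (fun p => A₂ p + t₂) '' fccStacking 1 (Real.sqrt (2 / 3)),
        (h + R₀ ≤ p 2 ∧ p 2 ≤ h + 2 * R₀ ∧ p 0 ^ 2 + p 1 ^ 2 ≤ ρ ^ 2) → ∃ i, x i = p) →
      (Real.sqrt 2 / 4 * ∑ᶠ w ∈ {w ∈ fccStacking 1 (Real.sqrt (2 / 3)) | ‖w‖ = 1},
          |⟪w, A₁.symm (EuclideanSpace.single (2 : Fin 3) (1 : ℝ))⟫_ℝ| +
        Real.sqrt 2 / 4 * ∑ᶠ w ∈ {w ∈ fccStacking 1 (Real.sqrt (2 / 3)) | ‖w‖ = 1},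
          |⟪w, A₂.symm (EuclideanSpace.single (2 : Fin 3) (1 : ℝ))⟫_ℝ| + c) * Real.pi * ρ ^ 2 - C * (1 + h) * ρ ≤
        6 * (N : ℝ) - (Summit.Ventures.Crystal3D.numContacts x : ℝ)) →
    TwoSlabLedgerWith (|C| + K * (1 + R₀)) R₀ c A₁ t₁ A₂ t₂ := by
  classical
  obtain ⟨Cu, hCu⟩ := affineSampleDeficit_upper_unif
  refine ⟨2 * |Cu|, by positivity, ?_⟩
  intro c A₁ t₁ A₂ t₂ C R₀ hR₀ hAt
  have hC₁ := hCu A₁ t₁ R₀ hR₀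
  have hC₂ := hCu A₂ t₂ R₀ hR₀
  intro h hh ρ hρ X P₁ P₂ hX hP₁X hP₂X hcell hP₁ hP₂
  -- enumerate `X` as a unit packing
  set N := X.card with hN
  set x : Fin N → EuclideanSpace ℝ (Fin 3) := fun i => ((X.equivFin.symm i : X) : _) with hxdef
  have hxmem : ∀ i, x i ∈ X := fun i => (X.equivFin.symm i).2
  have hxinj : Function.Injective x := fun i j hij => X.equivFin.symm.injective (Subtype.ext hij)
  have himage : univ.image x = X := by
    ext p
    simp only [mem_image, mem_univ, true_and]
    constructor
    · rintro ⟨i, rfl⟩; exact hxmem i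
    · intro hp; exact ⟨X.equivFin ⟨p, hp⟩, by simp [hxdef]⟩
  have hpack : Summit.Ventures.Crystal3D.IsUnitPacking x := fun i j hij =>
    hX (x i) (hxmem i) (x j) (hxmem j) fun heq => hij (hxinj heq)
  have hsurj : ∀ p ∈ X, ∃ i, x i = p := fun p hp => ⟨X.equivFin ⟨p, hp⟩, by simp [hxdef]⟩
  have hDX' := hAt h hh ρ hρ N x hpack (fun i => hcell (x i) (hxmem i))
    (fun p hpΛ hwin => hsurj p (hP₁X ((hP₁ p).2 ⟨hpΛ, hwin⟩)))
    (fun p hpΛ hwin => hsurj p (Finset.sdiff_subset (hP₂X ((hP₂ p).2 ⟨hpΛ, hwin⟩))))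
  rw [← contactDeficiency_image_eq x hxinj, himage] at hDX'
  have hρ0 : 0 ≤ ρ := by linarith
  have key := crossBound_of_deficiencyBound A₁ t₁ A₂ t₂ hρ hC₁ hC₂ X P₁ P₂ hP₁X hP₂X hP₁ hP₂ hDX'
  have hconst : (C * (1 + h) + Cu * (1 + R₀) + Cu * (1 + R₀)) * ρ ≤ (|C| + 2 * |Cu| * (1 + R₀)) * (1 + h) * ρ := by
    have h1 : C * (1 + h) ≤ |C| * (1 + h) := mul_le_mul_of_nonneg_right (le_abs_self C) (by linarith)
    have hR1 : 0 ≤ 1 + R₀ := by linarith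
    have h2 : Cu * (1 + R₀) ≤ |Cu| * (1 + R₀) * (1 + h) := by
      have := mul_le_mul_of_nonneg_right (le_abs_self Cu) hR1
      have h0 : 0 ≤ |Cu| * (1 + R₀) * h := by positivity
      nlinarith
    have h4 : C * (1 + h) + Cu * (1 + R₀) + Cu * (1 + R₀) ≤ (|C| + 2 * |Cu| * (1 + R₀)) * (1 + h) := by nlinarith
    exact mul_le_mul_of_nonneg_right h4 hρ0
  linarith only [key, hconst]

end Summit.Ventures.Crystal3D.Theorems

end
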